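import Mathlib
import Literature.AlgebraicGeometry.Resolution.ResolutionOfSingularities
import Literature.AlgebraicGeometry.Resolution.ResolutionGlue
import HarnessLib

/-!
# Gluing a resolution into a regular open (crux `FrobeniusLadder.FRationalResolution`, line `Sketch`)

Stub `stub_hasResolution_glue` of the skeleton `Sketch` for crux stmt-ResolutionOfSingularities-15317:
the OPEN GLUING step of the tower of point blow-ups resolving the `A_m` surfaces. A scheme `X` is
covered by the ranges of two open immersions `iU : U → X`, `iV : V → X`; `U` is regular and
`ρ : Y → V` is a proper morphism from a regular scheme which is an isomorphism over
`W := iV⁻¹(iU(U)) ⊆ V` with dense preimage `W' := ρ⁻¹(W) ⊆ Y`. Then `X` receives a proper morphism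
`π : X' → X` from a regular scheme, an isomorphism over `iU(U)` with dense preimage of `iU(U)`.

Construction: `X' := U ⨿_W Y` is the push-out of the two open immersions `b : W → U` (the
factorisation of `W ⊆ V → X` through `iU`) and `a : W ≅ W' ⊆ Y` (inverse of `ρ ∣_ W`), which Mathlib
provides as the colimit of a locally directed diagram of open immersions
(`Mathlib/AlgebraicGeometry/Gluing.lean`, section `IsLocallyDirected`, and the `span` instances of
`Mathlib/AlgebraicGeometry/Limits.lean`): the legs `U → X' ← Y` are open immersions and jointly
surjective. The map `π := pushout.desc iU (ρ ≫ iV)`. Pointwise bookkeeping gives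
`π⁻¹(iU(U)) = inl(U)` and `π⁻¹(iV(V)) = inr(Y)` (`openGlue_preimage_eq_range_inl/inr`), whence
`IsPullback (𝟙 U) inl iU π` and `IsPullback ρ inr iV π` (`IsOpenImmersion.isPullback`): so `π` is an
isomorphism over `iU(U)`, is `ρ` up to isomorphism over `iV(V)` (hence proper there), and proper
globally since properness is Zariski-local on the target; `X'` is regular because its stalks are stalks
of `U` or of `Y`; `inl(U)` is dense because `inr(W') ⊆ inl(U)` and `W'` is dense in `Y`.
-/

set_option linter.dupNamespace false

noncomputable section

open CategoryTheory CategoryTheory.Limits AlgebraicGeometry TopologicalSpace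
  Literature.AlgebraicGeometry.Resolution

universe u

namespace Summit.ResolutionOfSingularities.ResolutionOfSingularities.Theorems.FRationalResolution

section Pushout

variable {Wt U Y : Scheme.{u}} (b : Wt ⟶ U) (a : Wt ⟶ Y) [IsOpenImmersion b] [IsOpenImmersion a]

/-- Every point of the push-out `U ⨿_W Y` of two open immersions comes from `U` or from `Y`
(Mathlib: the legs of a locally directed colimit are jointly surjective). -/
theorem openGlue_point_cases (z : ↥(pushout b a)) :
    (∃ u : U, pushout.inl b a u = z) ∨ (∃ y : Y, pushout.inr b a y = z) := by
  obtain ⟨i, x, rfl⟩ := Scheme.IsLocallyDirected.ι_jointly_surjective (span b a) z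
  rcases i with _ | ⟨_ | _⟩
  · refine Or.inl ⟨b x, ?_⟩
    have h : b ≫ pushout.inl b a = colimit.ι (span b a) WalkingSpan.zero :=
      colimit.w (span b a) WalkingSpan.Hom.fst
    rw [← Scheme.Hom.comp_apply, h]
    rfl
  · exact Or.inl ⟨x, rfl⟩
  · exact Or.inr ⟨x, rfl⟩

/-- The leg `U → U ⨿_W Y` of the push-out of two open immersions is an open immersion (Mathlib,
locally directed colimits; restated for the `pushout` abbreviations). -/
theorem openGlue_isOpenImmersion_inl : IsOpenImmersion (pushout.inl b a) :=
  inferInstanceAs (IsOpenImmersion (colimit.ι (span b a) WalkingSpan.left))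

/-- The leg `Y → U ⨿_W Y` of the push-out of two open immersions is an open immersion (Mathlib,
locally directed colimits; restated for the `pushout` abbreviations). -/
theorem openGlue_isOpenImmersion_inr : IsOpenImmersion (pushout.inr b a) :=
  inferInstanceAs (IsOpenImmersion (colimit.ι (span b a) WalkingSpan.right))

/-- The two legs of the push-out agree on `W`, pointwise. -/
theorem openGlue_inl_apply (w : Wt) : pushout.inl b a (b w) = pushout.inr b a (a w) := by
  rw [← Scheme.Hom.comp_apply, pushout.condition, Scheme.Hom.comp_apply]

/-- The push-out of two open immersions out of regular schemes is regular: its local rings are local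
rings of `U` or of `Y` (the legs are open immersions, hence induce isomorphisms on stalks). -/
theorem openGlue_isRegular (hU : Scheme.IsRegular U) (hY : Scheme.IsRegular Y) :
    Scheme.IsRegular (pushout b a) := by
  haveI := openGlue_isOpenImmersion_inl b a
  haveI := openGlue_isOpenImmersion_inr b a
  intro z
  rcases openGlue_point_cases b a z with ⟨u, rfl⟩ | ⟨y, rfl⟩
  · haveI := hU u
    exact IsRegularLocalRing.of_ringEquiv
      (asIso ((pushout.inl b a).stalkMap u)).commRingCatIsoToRingEquiv.symm
  · haveI := hY y
    exact IsRegularLocalRing.of_ringEquiv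
      (asIso ((pushout.inr b a).stalkMap y)).commRingCatIsoToRingEquiv.symm

/-- If the range of `a` is dense in `Y`, the image of `U` is dense in the push-out `U ⨿_W Y`
(it contains the image of `W` in `Y`). -/
theorem openGlue_dense_range_inl (hd : Dense (Set.range a)) :
    Dense (Set.range (pushout.inl b a)) := by
  intro z
  rcases openGlue_point_cases b a z with ⟨u, rfl⟩ | ⟨y, rfl⟩
  · exact subset_closure ⟨u, rfl⟩
  · have h1 : pushout.inr b a y ∈ closure (pushout.inr b a '' Set.range a) :=
      image_closure_subset_closure_image (pushout.inr b a).continuous ⟨y, hd y, rfl⟩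
    refine closure_mono ?_ h1
    rintro _ ⟨_, ⟨w, rfl⟩, rfl⟩
    exact ⟨b w, openGlue_inl_apply b a w⟩

variable {X : Scheme.{u}} (π : pushout b a ⟶ X) (O : X.Opens)

/-- If `O ⊆ X` contains the image of `U` and the points of `Y` over `O` come from `W`, then the
preimage of `O` in the push-out is exactly the image of `U`. -/
theorem openGlue_preimage_eq_range_inl (h₁ : ∀ u : U, π (pushout.inl b a u) ∈ O)
    (h₂ : ∀ y : Y, π (pushout.inr b a y) ∈ O → y ∈ Set.range a) :
    ((π ⁻¹ᵁ O : (pushout b a).Opens) : Set ↥(pushout b a)) = Set.range (pushout.inl b a) := by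
  ext z
  constructor
  · intro hz
    rcases openGlue_point_cases b a z with ⟨u, rfl⟩ | ⟨y, rfl⟩
    · exact ⟨u, rfl⟩
    · obtain ⟨w, rfl⟩ := h₂ y hz
      exact ⟨b w, openGlue_inl_apply b a w⟩
  · rintro ⟨u, rfl⟩
    exact h₁ u

/-- If `O ⊆ X` contains the image of `Y` and the points of `U` over `O` come from `W`, then the
preimage of `O` in the push-out is exactly the image of `Y`. -/
theorem openGlue_preimage_eq_range_inr (h₁ : ∀ y : Y, π (pushout.inr b a y) ∈ O)
    (h₂ : ∀ u : U, π (pushout.inl b a u) ∈ O → u ∈ Set.range b) :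
    ((π ⁻¹ᵁ O : (pushout b a).Opens) : Set ↥(pushout b a)) = Set.range (pushout.inr b a) := by
  ext z
  constructor
  · intro hz
    rcases openGlue_point_cases b a z with ⟨u, rfl⟩ | ⟨y, rfl⟩
    · obtain ⟨w, rfl⟩ := h₂ u hz
      exact ⟨a w, (openGlue_inl_apply b a w).symm⟩
    · exact ⟨y, rfl⟩
  · rintro ⟨y, rfl⟩
    exact h₁ y

end Pushout

/-- Restriction over the range of an open immersion `i : V → X`: if `π⁻¹(i(V))` is the range of an open
immersion `j : Y → X'` with `j ≫ π = ρ ≫ i`, then the square is cartesian and `π ∣_ i(V)` is `ρ` up to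
isomorphism, so every isomorphism-invariant property passes from `ρ` to `π ∣_ i(V)`. -/
theorem openGlue_morphismRestrict_opensRange {X' X Y V : Scheme.{u}} (π : X' ⟶ X) (j : Y ⟶ X')
    [IsOpenImmersion j] (ρ : Y ⟶ V) (i : V ⟶ X) [IsOpenImmersion i] (hj : j ≫ π = ρ ≫ i)
    (h : π ⁻¹ᵁ i.opensRange = j.opensRange) (P : MorphismProperty Scheme.{u}) [P.RespectsIso]
    (hρ : P ρ) : P (π ∣_ i.opensRange) := by
  have sq : IsPullback ρ j i π := IsOpenImmersion.isPullback ρ j i π hj h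
  have h1 : P (pullback.snd π i) := by
    rw [← sq.flip.isoPullback_inv_snd]
    exact (P.cancel_left_of_respectsIso _ _).mpr hρ
  exact (P.arrow_mk_iso_iff (morphismRestrictOpensRange π i)).mpr h1

/-- GLUING A RESOLUTION INTO A REGULAR OPEN (open gluing infrastructure). `X` a scheme covered by the
ranges of two open immersions `iU : U → X`, `iV : V → X`, with `U` regular, and `ρ : Y → V` proper
from a regular `Y` which is an ISOMORPHISM over `U ∩ V ⊆ V` (and whose preimage of `U ∩ V` is dense
in `Y`). Then `X` receives a proper morphism `π : X' → X` from a regular scheme which is an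
isomorphism over `U` (with dense preimage of `U`): `X' = U ⨿_{U ∩ V} Y`, the push-out of the open
immersions `U ∩ V → U` and `U ∩ V ≅ ρ⁻¹(U ∩ V) → Y`, `π = pushout.desc iU (ρ ≫ iV)`;
`π⁻¹(U) = inl(U) ≅ U` and `π⁻¹(V) = inr(Y) ≅ Y` over `V`, so `π` is proper (`IsProper` is
Zariski-local at the target) and `X'` is regular (stalks of open subschemes).
[Stacks 01JA (gluing schemes); folklore] -/
theorem stub_hasResolution_glue (X U V Y : Scheme.{0}) (iU : U ⟶ X) [IsOpenImmersion iU]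
    (iV : V ⟶ X) [IsOpenImmersion iV] (hcover : iU.opensRange ⊔ iV.opensRange = ⊤)
    (hU : Scheme.IsRegular U) (ρ : Y ⟶ V) [IsProper ρ] (hY : Scheme.IsRegular Y)
    (hiso : IsIso (ρ ∣_ (iV ⁻¹ᵁ iU.opensRange)))
    (hd : Dense ((ρ ⁻¹ᵁ (iV ⁻¹ᵁ iU.opensRange) : Y.Opens) : Set Y)) :
    ∃ (X' : Scheme.{0}) (π : X' ⟶ X), IsProper π ∧ Scheme.IsRegular X' ∧
      IsIso (π ∣_ iU.opensRange) ∧ Dense ((π ⁻¹ᵁ iU.opensRange : X'.Opens) : Set X') := by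
  -- `O = iU(U)`, `W = U ∩ V` seen in `V`
  set O : X.Opens := iU.opensRange
  set W : V.Opens := iV ⁻¹ᵁ O
  -- the open immersion `b : W → U`
  have hrange : Set.range (W.ι ≫ iV) ⊆ Set.range iU := by
    rintro _ ⟨w, rfl⟩
    rw [Scheme.Hom.comp_apply]
    exact w.2
  set b : (W : Scheme.{0}) ⟶ U := IsOpenImmersion.lift iU (W.ι ≫ iV) hrange
  have hb : b ≫ iU = W.ι ≫ iV := IsOpenImmersion.lift_fac _ _ _
  haveI : IsOpenImmersion b := by
    haveI : IsOpenImmersion (b ≫ iU) := by rw [hb]; infer_instance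
    exact IsOpenImmersion.of_comp b iU
  -- the open immersion `a : W ≅ W' → Y`
  set a : (W : Scheme.{0}) ⟶ Y := inv (ρ ∣_ W) ≫ (ρ ⁻¹ᵁ W).ι with ha_def
  -- points of `W'` are in the range of `a`
  have ha : ∀ y : Y, y ∈ ρ ⁻¹ᵁ W → y ∈ Set.range a := by
    intro y hy
    refine ⟨(ρ ∣_ W) ⟨y, hy⟩, ?_⟩
    rw [ha_def, Scheme.Hom.comp_apply, ← Scheme.Hom.comp_apply (ρ ∣_ W) (inv (ρ ∣_ W)),
      IsIso.hom_inv_id]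
    rfl
  -- the two maps to `X` agree on `W`
  have hcomm : b ≫ iU = a ≫ ρ ≫ iV := by
    rw [hb, ha_def, Category.assoc, ← morphismRestrict_ι_assoc, IsIso.inv_hom_id_assoc]
  set π : pushout b a ⟶ X := pushout.desc iU (ρ ≫ iV) hcomm
  have hπl : pushout.inl b a ≫ π = iU := pushout.inl_desc _ _ _
  have hπr : pushout.inr b a ≫ π = ρ ≫ iV := pushout.inr_desc _ _ _
  haveI := openGlue_isOpenImmersion_inl b a
  haveI := openGlue_isOpenImmersion_inr b a
  -- `π⁻¹(iU(U)) = inl(U)`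
  have hA : π ⁻¹ᵁ O = (pushout.inl b a).opensRange := by
    refine Opens.ext ?_
    rw [Scheme.Hom.coe_opensRange]
    refine openGlue_preimage_eq_range_inl b a π O (fun u => ?_) (fun y hy => ?_)
    · rw [← Scheme.Hom.comp_apply, hπl]
      exact ⟨u, rfl⟩
    · rw [← Scheme.Hom.comp_apply, hπr, Scheme.Hom.comp_apply] at hy
      exact ha y hy
  -- `π⁻¹(iV(V)) = inr(Y)`
  have hB : π ⁻¹ᵁ iV.opensRange = (pushout.inr b a).opensRange := by
    refine Opens.ext ?_
    rw [Scheme.Hom.coe_opensRange]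
    refine openGlue_preimage_eq_range_inr b a π _ (fun y => ?_) (fun u hu => ?_)
    · rw [← Scheme.Hom.comp_apply, hπr, Scheme.Hom.comp_apply]
      exact ⟨ρ y, rfl⟩
    · rw [← Scheme.Hom.comp_apply, hπl] at hu
      obtain ⟨v, hv⟩ := hu
      have hvW : v ∈ W := by
        show iV v ∈ O
        rw [hv]
        exact ⟨u, rfl⟩
      refine ⟨⟨v, hvW⟩, iU.isOpenEmbedding.injective ?_⟩
      rw [← Scheme.Hom.comp_apply, hb, Scheme.Hom.comp_apply]
      exact hv
  -- over `iU(U)` the map `π` is an isomorphism, over `iV(V)` it is `ρ`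
  have hisoO : IsIso (π ∣_ O) :=
    openGlue_morphismRestrict_opensRange π (pushout.inl b a) (𝟙 U) iU
      (by rw [hπl, Category.id_comp]) hA (MorphismProperty.isomorphisms Scheme.{0})
      (show IsIso (𝟙 U) from inferInstance)
  have hpropV : IsProper (π ∣_ iV.opensRange) :=
    openGlue_morphismRestrict_opensRange π (pushout.inr b a) ρ iV hπr hB @IsProper inferInstance
  refine ⟨pushout b a, π, ?_, openGlue_isRegular b a hU hY, hisoO, ?_⟩
  · -- properness is Zariski-local on the target
    have hpropO : IsProper (π ∣_ O) := inferInstance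
    refine IsZariskiLocalAtTarget.of_iSup_eq_top (P := @IsProper)
      (fun c : Bool => cond c O iV.opensRange) ((sup_eq_iSup _ _).symm.trans hcover) ?_
    rintro (_ | _)
    · exact hpropV
    · exact hpropO
  · -- density of `π⁻¹(iU(U)) = inl(U)`
    rw [hA, Scheme.Hom.coe_opensRange]
    exact openGlue_dense_range_inl b a (hd.mono fun y hy => ha y hy)

end Summit.ResolutionOfSingularities.ResolutionOfSingularities.Theorems.FRationalResolution

end
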